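import Literature.NumberTheory.EllipticCurves.ZpExtensionEisensteinTwistCores
import HarnessLib

/-!
# The coefficient-extraction map `M ⊗ A_{m,1}(ψ) → 𝒯_{p^n} = M ⊗ 𝔽_p[T]/(T^{p^n})(χ)` (`p^n ≤ m`) from Howard's
# level-one Eisenstein module onto the Shapiro module of the Iwasawa twists, its compatibility with the unit maps,
# and the consequence «`coresEisenstein` at `(m, k = 1)` detects the classes of `H¹(K_n, M)`»
# (definitions with bodies + theorems; no named fact, no instance, no notation)

Topic `NumberTheory/EllipticCurves` (companion of `ZpExtensionEisensteinTwistCores` (D1 lineage, cell `pub/bsd-print-x9`)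
and `IwasawaTwistModPShapiroCores` (cell `bsd-smallim`)). Namespace `Literature.NumberTheory.EllipticCurves.ZpExtension`.

SETTING. `κ : ZpExtension K p`, `ρ` a discrete `Γ_K`-module on `M` killed by `p` (`hM`), `m ≥ 1`, and `n` with `p^n ≤ m`.
Level one of Howard's specialised module is `M ⊗ A_{m,1}(ψ)` with `A_{m,1} = Λ/(T^m + p, p) = 𝔽_p[T]/(T^m)`
(`κ.eisensteinTwist ρ hm 1`, [Howard 2004, §2.2, 𝔮 = (T^m + p)]); the Shapiro module of the tree is
`𝒯_{p^n} = (Fin p^n → M)` with `σ ↦ (1+S)^{κ(σ)} ∘ ρ(σ)` (`κ.twistModP ρ hM (p^n)`, `IwasawaTwistModP`), for which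
`coresShapiro n : H¹(K_n, M) → H¹(K, 𝒯_{p^n})` is a bijection (`coresShapiro_bijective`, Serre I §2.5).

WHAT.
* §1 arithmetic of `p`-torsion modules: `((z : ZMod p).val : ℤ) • a` only depends on `z` and is additive (`p • a = 0`).
* §2 the coefficient functionals `f ↦ (coeff_i f mod p)` vanish on `(T^m + p, p)` for `i < m`
  (`toZMod_coeff_eq_zero_of_mem`).
* §3 **`ZpExtension.eisensteinToTwistModPAdd κ ρ hM hm n hn : M ⊗ A_{m,1} →+ (Fin p^n → M)`**, `c ⊗ a ↦ (i ↦ (coeff_i c mod p) • a)`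
  (`TensorProduct.liftAddHom` of a bilinear map descended to `Λ/(T^m+p, p)` by `Submodule.liftQ`); values on pure tensors
  (`eisensteinToTwistModPAdd_tmul_mk`); `T` acts as the shift `S` (`…_mk_X_smul`), `T^j` as `S^j`, hence
  **`T^j` is killed for `p^n ≤ j`** (`…_mk_X_pow_smul_eq_zero`); the unit `1 ⊗ a ↦ a · T⁰` (`…_eisensteinUnitCoeff`).
* §4 **equivariance**: `ZpExtension.eisensteinToTwistModP … : (κ.eisensteinTwist ρ hm 1) →ⁱL (κ.twistModP ρ hM (p^n))`
  (the twisting exponents agree modulo `p^n`, and `(1+T) ↦ 1 + S`).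
* §5 cohomology: **`map_eisensteinToTwistModP_coresEisenstein`**:
  `H¹(Ξ) ∘ coresEisenstein_{(m,1),N} = coresShapiro n ∘ cor_{N → Γ_n}` (`N ≤ Γ_n`, `N ≤ Γ_{J(m,1)}` open of finite index);
  hence **`coresLe_eq_zero_of_coresEisenstein_eq_zero`**: a class of `H¹(N, M)` whose image under Howard's level-one
  control map vanishes has zero corestriction to `H¹(K_n, M)`; and **`map_eisensteinToTwistModP_map_smul_X_pow`**:
  `H¹(Ξ)` kills `H¹([T^j] •)` for `p^n ≤ j`.

WHY (cell `pub/bsd-print-x9`, S1 = STUB 3 of the shared μ-item, COMPACT side, step (I4) of the rank-one route; memo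
`HOME/x10b-p1-w2/S1-COKERNEL-BLUEPRINT-x10b-p1-w2-g8.md`): with `θ := H¹(Ξ) ∘ proj₁` on the pinned `H_m = H¹(K, T_𝔮)`,
`θ` kills `T^{p^n} • H_m` and sends the control image `f_m(e)` of `e ∈ 𝔖` to `coresShapiro n (e_{n,1})`, which is non-zero
as soon as `e_{n,1} ≠ 0` — the input `f_m(e) ∉ T^{p^n} • H_m` of `IwasawaAlgebra.finite_quotient_range_and_natCard_le_of_not_mem_X_pow_smul`
(p653099), uniformly in `m ≥ p^n`. Nothing about elliptic curves or Selmer groups is asserted here; BSD is not proved by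
any of this.

References: [Howard2004HeegnerKolyvagin] B. Howard, Compositio Math. 140 (2004), §2.2, Def. 2.2.3, Lemma 2.2.7 / Prop. 2.2.8,
proof of Thm. 2.2.10 (𝔮 = T^m + p); [SerreGaloisCohomology1997] I §2.5 (Shapiro; Cor through the induced module);
[Washington1997] §13.1–§13.2 (`Λ/(p, T^J)`, `T = γ − 1`); [MazurRubinMemoirs2004] §5.3.
-/

noncomputable section

open scoped TensorProduct Topology ContRepresentation
open Field Filter CategoryTheory

universe u

namespace Literature.NumberTheory.EllipticCurves

open Literature.NumberTheory.GaloisRepresentations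

namespace ZpExtension

/-! ## §1 `p`-torsion modules: the scalar `(z.val : ℤ) •` for `z ∈ ℤ/p` -/

section TorsionScalars

variable {p : ℕ} [hp : Fact p.Prime] {M : Type u} [AddCommGroup M] (hM : ∀ x : M, p • x = 0)
include hM

/-- On a module killed by `p`, `((z mod p).val : ℤ) • a = z • a` for every integer `z`.
[cite: Washington1997, §13.1–§13.2 (modules over Λ/(p, T^J))] -/
theorem val_intCast_zsmul (z : ℤ) (a : M) : (((z : ZMod p).val : ℕ) : ℤ) • a = z • a := by
  rw [ZMod.val_intCast, Int.emod_def, sub_smul, mul_comm, mul_smul, natCast_zsmul, hM, smul_zero, sub_zero]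

/-- Additivity of `z ↦ (z.val : ℤ) • a` on `ℤ/p` (for `p • a = 0`). [cite: Washington1997, §13.1–§13.2] -/
theorem val_add_zsmul (x y : ZMod p) (a : M) :
    (((x + y).val : ℕ) : ℤ) • a = ((x.val : ℕ) : ℤ) • a + ((y.val : ℕ) : ℤ) • a := by
  have hx : (x : ZMod p) = ((x.val : ℤ) : ZMod p) := by rw [Int.cast_natCast, ZMod.natCast_zmod_val]
  have hy : (y : ZMod p) = ((y.val : ℤ) : ZMod p) := by rw [Int.cast_natCast, ZMod.natCast_zmod_val]
  conv_lhs => rw [hx, hy, ← Int.cast_add, val_intCast_zsmul hM]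
  rw [add_smul]

/-- Multiplicativity: `((x y).val : ℤ) • a = (x.val : ℤ) • ((y.val : ℤ) • a)` (for `p • a = 0`).
[cite: Washington1997, §13.1–§13.2] -/
theorem val_mul_zsmul (x y : ZMod p) (a : M) :
    (((x * y).val : ℕ) : ℤ) • a = ((x.val : ℕ) : ℤ) • (((y.val : ℕ) : ℤ) • a) := by
  have hx : (x : ZMod p) = ((x.val : ℤ) : ZMod p) := by rw [Int.cast_natCast, ZMod.natCast_zmod_val]
  have hy : (y : ZMod p) = ((y.val : ℤ) : ZMod p) := by rw [Int.cast_natCast, ZMod.natCast_zmod_val]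
  conv_lhs => rw [hx, hy, ← Int.cast_mul, val_intCast_zsmul hM]
  rw [mul_smul]

end TorsionScalars

/-! ## §2 The coefficient functionals `coeff_i mod p` vanish on `(T^m + p, p)` below degree `m` -/

section Coefficients

variable (p : ℕ) [hp : Fact p.Prime]

/-- `p ↦ 0` under `ℤ_p → ℤ/p`. [folklore] -/
private theorem toZMod_natCast_prime : PadicInt.toZMod (p := p) (p : ℤ_[p]) = 0 := by
  rw [map_natCast, ZMod.natCast_self]

/-- For `f ∈ (T^m + p, p) ⊂ Λ` and `i < m`, the `i`-th coefficient of `f` is divisible by `p`: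
`coeff_i f ≡ 0 (mod p)`. [cite: Washington1997, §7.1 (division by distinguished polynomials) and §13.2] -/
theorem toZMod_coeff_eq_zero_of_mem {m i : ℕ} (hi : i < m) {f : IwasawaAlgebra p}
    (hf : f ∈ Ideal.span {(PowerSeries.X ^ m + PowerSeries.C (p : ℤ_[p]) : IwasawaAlgebra p)} ⊔
      Ideal.span {PowerSeries.C ((p : ℤ_[p]) ^ 1)}) :
    PadicInt.toZMod (PowerSeries.coeff i f) = 0 := by
  obtain ⟨a, ha, b, hb, rfl⟩ := Submodule.mem_sup.1 hf
  obtain ⟨g, rfl⟩ := Ideal.mem_span_singleton'.1 ha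
  obtain ⟨h, rfl⟩ := Ideal.mem_span_singleton'.1 hb
  rw [map_add, mul_add, map_add, map_add, PowerSeries.coeff_mul_X_pow', if_neg (not_le.2 hi), zero_add, pow_one,
    PowerSeries.coeff_mul_C, PowerSeries.coeff_mul_C, map_mul, map_mul, toZMod_natCast_prime, mul_zero, mul_zero,
    add_zero]

end Coefficients

/-! ## §3 The additive coefficient-extraction map `M ⊗ A_{m,1} → (Fin p^n → M)` -/

section Extraction

variable {p : ℕ} [hp : Fact p.Prime] {M : Type u} [AddCommGroup M]

/-- The bilinear map `Λ × M → (Fin p^n → M)`, `(f, a) ↦ (i ↦ (coeff_i f mod p) • a)` (as `f ↦` an additive map of `a`).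
[cite: Washington1997, §13.1–§13.2 (coordinates w.r.t. 1, T, …, T^{J−1})] -/
def coeffExtractAux (hM : ∀ x : M, p • x = 0) (n : ℕ) : IwasawaAlgebra p →+ (M →+ (Fin (p ^ n) → M)) where
  toFun f :=
    { toFun := fun a i ↦ (((PadicInt.toZMod (PowerSeries.coeff (i : ℕ) f)).val : ℕ) : ℤ) • a
      map_zero' := funext fun _ ↦ smul_zero _
      map_add' := fun a b ↦ funext fun _ ↦ smul_add _ _ _ }
  map_zero' := by
    ext a i
    simp only [map_zero, ZMod.val_zero, Nat.cast_zero, zero_smul, AddMonoidHom.coe_mk, ZeroHom.coe_mk,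
      AddMonoidHom.zero_apply, Pi.zero_apply]
  map_add' f g := by
    ext a i
    simp only [map_add, AddMonoidHom.coe_mk, ZeroHom.coe_mk, AddMonoidHom.add_apply, Pi.add_apply]
    exact val_add_zsmul hM _ _ a

/-- Values of `coeffExtractAux`. [cite: Washington1997, §13.1–§13.2] -/
@[simp] theorem coeffExtractAux_apply (hM : ∀ x : M, p • x = 0) (n : ℕ) (f : IwasawaAlgebra p) (a : M)
    (i : Fin (p ^ n)) :
    coeffExtractAux (p := p) hM n f a i = (((PadicInt.toZMod (PowerSeries.coeff (i : ℕ) f)).val : ℕ) : ℤ) • a := rfl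

/-- `coeffExtractAux` vanishes on the ideal `(T^m + p, p)` when `p^n ≤ m` (the coefficients below `m` of its elements are
divisible by `p`). [cite: Washington1997, §7.1 and §13.2] -/
theorem coeffExtractAux_eq_zero_of_mem (hM : ∀ x : M, p • x = 0) {m : ℕ} (n : ℕ) (hn : p ^ n ≤ m)
    {f : IwasawaAlgebra p}
    (hf : f ∈ Ideal.span {(PowerSeries.X ^ m + PowerSeries.C (p : ℤ_[p]) : IwasawaAlgebra p)} ⊔
      Ideal.span {PowerSeries.C ((p : ℤ_[p]) ^ 1)}) :
    coeffExtractAux (p := p) hM n f = 0 := by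
  ext a i
  rw [coeffExtractAux_apply, toZMod_coeff_eq_zero_of_mem p (lt_of_lt_of_le i.2 hn) hf, ZMod.val_zero, Nat.cast_zero,
    zero_smul]
  rfl

/-- The descent of `coeffExtractAux` to `A_{m,1} = Λ/(T^m + p, p)` (`p^n ≤ m`), as a `ℤ`-linear map
`A_{m,1} → (M →+ (Fin p^n → M))`. [cite: Washington1997, §13.1–§13.2] -/
def coeffExtract (hM : ∀ x : M, p • x = 0) {m : ℕ} (n : ℕ) (hn : p ^ n ≤ m) :
    IwasawaAlgebra.EisensteinCoeff p m 1 →ₗ[ℤ] (M →+ (Fin (p ^ n) → M)) :=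
  (((Ideal.span {(PowerSeries.X ^ m + PowerSeries.C (p : ℤ_[p]) : IwasawaAlgebra p)} ⊔
      Ideal.span {PowerSeries.C ((p : ℤ_[p]) ^ 1)}).restrictScalars ℤ).liftQ
    (coeffExtractAux (p := p) hM n).toIntLinearMap (fun f hf ↦ by
      rw [LinearMap.mem_ker, AddMonoidHom.coe_toIntLinearMap]
      exact coeffExtractAux_eq_zero_of_mem hM n hn hf)).comp
    (Submodule.Quotient.restrictScalarsEquiv ℤ
      (Ideal.span {(PowerSeries.X ^ m + PowerSeries.C (p : ℤ_[p]) : IwasawaAlgebra p)} ⊔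
        Ideal.span {PowerSeries.C ((p : ℤ_[p]) ^ 1)})).symm.toLinearMap

/-- `coeffExtract` on classes: `coeffExtract [f] = coeffExtractAux f`. [cite: Washington1997, §13.1–§13.2] -/
@[simp] theorem coeffExtract_mk (hM : ∀ x : M, p • x = 0) {m : ℕ} (n : ℕ) (hn : p ^ n ≤ m) (f : IwasawaAlgebra p) :
    coeffExtract (p := p) hM n hn (Ideal.Quotient.mk _ f) = coeffExtractAux (p := p) hM n f :=
  rfl

/-- **The coefficient-extraction map `Ξ : M ⊗ A_{m,1} → (Fin p^n → M)`**, `c ⊗ a ↦ (i ↦ (coeff_i c mod p) • a)` for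
`p^n ≤ m` — the additive map underlying the comparison of Howard's level-one module `T_𝔮/π T_𝔮`-type carrier with the
Shapiro module `𝒯_{p^n}`. [cite: Howard2004HeegnerKolyvagin, §2.2 (T_𝔮 = 𝐓 ⊗_Λ S_𝔮)] [cite: Washington1997, §13.1–§13.2] -/
def eisensteinToTwistModPAdd (hM : ∀ x : M, p • x = 0) {m : ℕ} (n : ℕ) (hn : p ^ n ≤ m) :
    IwasawaAlgebra.EisensteinCoeff.Twisted p m 1 M →+ (Fin (p ^ n) → M) :=
  (TensorProduct.liftAddHom (R := ℤ) (coeffExtract (p := p) hM n hn).toAddMonoidHom (fun r c a ↦ by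
      change coeffExtract (p := p) hM n hn (r • c) a = coeffExtract (p := p) hM n hn c (r • a)
      rw [map_smul, AddMonoidHom.smul_apply, map_zsmul]) :
    IwasawaAlgebra.EisensteinCoeff p m 1 ⊗[ℤ] M →+ (Fin (p ^ n) → M))

/-- **`Ξ` on pure tensors**: `Ξ ([f] ⊗ a) = (i ↦ (coeff_i f mod p) • a)`. [cite: Washington1997, §13.1–§13.2] -/
theorem eisensteinToTwistModPAdd_tmul_mk (hM : ∀ x : M, p • x = 0) {m : ℕ} (n : ℕ) (hn : p ^ n ≤ m)
    (f : IwasawaAlgebra p) (a : M) :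
    eisensteinToTwistModPAdd (p := p) hM n hn (IwasawaAlgebra.EisensteinCoeff.Twisted.tmul (Ideal.Quotient.mk _ f) a) =
      fun i : Fin (p ^ n) ↦ (((PadicInt.toZMod (PowerSeries.coeff (i : ℕ) f)).val : ℕ) : ℤ) • a := by
  change TensorProduct.liftAddHom (R := ℤ) (coeffExtract (p := p) hM n hn).toAddMonoidHom _
    ((Ideal.Quotient.mk _ f) ⊗ₜ[ℤ] a) = _
  rw [TensorProduct.liftAddHom_tmul, LinearMap.toAddMonoidHom_coe, coeffExtract_mk]
  rfl

/-- **`T` acts as the shift `S`**: `Ξ ([T] • x) = S (Ξ x)` (`coeff_{i+1}(T f) = coeff_i f`, `coeff_0(T f) = 0`).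
[cite: Washington1997, §13.1–§13.2 (T = γ − 1 on Λ/(p, T^J))] -/
theorem eisensteinToTwistModPAdd_mk_X_smul (hM : ∀ x : M, p • x = 0) {m : ℕ} (n : ℕ) (hn : p ^ n ≤ m)
    (x : IwasawaAlgebra.EisensteinCoeff.Twisted p m 1 M) :
    eisensteinToTwistModPAdd (p := p) hM n hn
        ((Ideal.Quotient.mk _ (PowerSeries.X : IwasawaAlgebra p) : IwasawaAlgebra.EisensteinCoeff p m 1) • x) =
      shiftEnd M (p ^ n) (eisensteinToTwistModPAdd (p := p) hM n hn x) := by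
  induction x using IwasawaAlgebra.EisensteinCoeff.Twisted.induction_on with
  | zero => rw [smul_zero, map_zero, map_zero]
  | tmul c a =>
    obtain ⟨f, rfl⟩ := Ideal.Quotient.mk_surjective c
    rw [IwasawaAlgebra.EisensteinCoeff.Twisted.smul_tmul, ← map_mul, eisensteinToTwistModPAdd_tmul_mk,
      eisensteinToTwistModPAdd_tmul_mk]
    funext i
    rw [shiftEnd_apply]
    by_cases hi : (i : ℕ) = 0
    · rw [dif_pos hi, hi, PowerSeries.coeff_zero_X_mul, map_zero, ZMod.val_zero, Nat.cast_zero, zero_smul]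
    · rw [dif_neg hi]
      have h' : (i : ℕ) = ((i : ℕ) - 1) + 1 := by omega
      conv_lhs => rw [h', PowerSeries.coeff_succ_X_mul]
  | add x y hx hy => rw [smul_add, map_add, hx, hy, map_add, map_add]

/-- Iterating: `Ξ ([T]^j • x) = S^j (Ξ x)`. [cite: Washington1997, §13.1–§13.2] -/
theorem eisensteinToTwistModPAdd_mk_X_pow_smul (hM : ∀ x : M, p • x = 0) {m : ℕ} (n : ℕ) (hn : p ^ n ≤ m) (j : ℕ)
    (x : IwasawaAlgebra.EisensteinCoeff.Twisted p m 1 M) :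
    eisensteinToTwistModPAdd (p := p) hM n hn
        (((Ideal.Quotient.mk _ (PowerSeries.X : IwasawaAlgebra p) : IwasawaAlgebra.EisensteinCoeff p m 1) ^ j) • x) =
      (shiftEnd M (p ^ n) ^ j) (eisensteinToTwistModPAdd (p := p) hM n hn x) := by
  induction j generalizing x with
  | zero => rw [pow_zero, one_smul, pow_zero, Module.End.one_apply]
  | succ j ih =>
    rw [pow_succ' (Ideal.Quotient.mk _ PowerSeries.X : IwasawaAlgebra.EisensteinCoeff p m 1) j, mul_smul,
      eisensteinToTwistModPAdd_mk_X_smul, ih, pow_succ' (shiftEnd M (p ^ n)) j, Module.End.mul_apply]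

/-- **`Ξ` kills `T^j • (M ⊗ A_{m,1})` for `p^n ≤ j`** (`S^j = 0` on `Fin p^n → M`).
[cite: Washington1997, §13.1–§13.2 (T^J = 0 on Λ/(p, T^J))] -/
theorem eisensteinToTwistModPAdd_mk_X_pow_smul_eq_zero (hM : ∀ x : M, p • x = 0) {m : ℕ} (n : ℕ) (hn : p ^ n ≤ m)
    {j : ℕ} (hj : p ^ n ≤ j) (x : IwasawaAlgebra.EisensteinCoeff.Twisted p m 1 M) :
    eisensteinToTwistModPAdd (p := p) hM n hn
        ((Ideal.Quotient.mk _ ((PowerSeries.X : IwasawaAlgebra p) ^ j) : IwasawaAlgebra.EisensteinCoeff p m 1) • x) = 0 := by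
  rw [map_pow (Ideal.Quotient.mk _) (PowerSeries.X : IwasawaAlgebra p) j, eisensteinToTwistModPAdd_mk_X_pow_smul,
    shiftEnd_pow_eq_zero hj, LinearMap.zero_apply]

/-- **`1 + T` acts as `1 + S`**: `Ξ ((1 + [T]) • x) = Ξ x + S (Ξ x)`. [cite: Washington1997, §13.1–§13.2] -/
theorem eisensteinToTwistModPAdd_onePlusT_smul (hM : ∀ x : M, p • x = 0) {m : ℕ} (n : ℕ) (hn : p ^ n ≤ m)
    (x : IwasawaAlgebra.EisensteinCoeff.Twisted p m 1 M) :
    eisensteinToTwistModPAdd (p := p) hM n hn (IwasawaAlgebra.EisensteinCoeff.onePlusT p m 1 • x) =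
      (1 + shiftEnd M (p ^ n)) (eisensteinToTwistModPAdd (p := p) hM n hn x) := by
  rw [IwasawaAlgebra.EisensteinCoeff.onePlusT_def, map_add, map_one, add_smul, one_smul, map_add,
    eisensteinToTwistModPAdd_mk_X_smul, LinearMap.add_apply, Module.End.one_apply]

/-- Iterated: `Ξ ((1 + [T])^e • x) = (1 + S)^e (Ξ x)` (`unipotentPow`). [cite: Washington1997, §13.1–§13.2] -/
theorem eisensteinToTwistModPAdd_onePlusT_pow_smul (hM : ∀ x : M, p • x = 0) {m : ℕ} (n : ℕ) (hn : p ^ n ≤ m)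
    (e : ℕ) (x : IwasawaAlgebra.EisensteinCoeff.Twisted p m 1 M) :
    eisensteinToTwistModPAdd (p := p) hM n hn (IwasawaAlgebra.EisensteinCoeff.onePlusT p m 1 ^ e • x) =
      unipotentPow M (p ^ n) e (eisensteinToTwistModPAdd (p := p) hM n hn x) := by
  induction e generalizing x with
  | zero => rw [pow_zero, one_smul, unipotentPow_zero, Module.End.one_apply]
  | succ e ih =>
    have h1 : unipotentPow M (p ^ n) 1 = 1 + shiftEnd M (p ^ n) := pow_one _
    rw [pow_succ (IwasawaAlgebra.EisensteinCoeff.onePlusT p m 1) e, mul_smul, ih, eisensteinToTwistModPAdd_onePlusT_smul,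
      unipotentPow_add, Module.End.mul_apply, h1]

/-- **`Ξ` on the unit**: `Ξ (1 ⊗ a) = a · T⁰` (`eisensteinUnitCoeff ↦ unitCoeff`).
[cite: SerreGaloisCohomology1997, I §2.5 (the unit of Shapiro's lemma)] -/
theorem eisensteinToTwistModPAdd_eisensteinUnitCoeff (hM : ∀ x : M, p • x = 0) {m : ℕ} (n : ℕ) (hn : p ^ n ≤ m)
    (a : M) :
    eisensteinToTwistModPAdd (p := p) hM n hn (eisensteinUnitCoeff p m 1 a) = unitCoeff (p := p) n a := by
  haveI : Fact (1 < p) := ⟨hp.out.one_lt⟩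
  rw [eisensteinUnitCoeff_apply, ← map_one (Ideal.Quotient.mk _), eisensteinToTwistModPAdd_tmul_mk, unitCoeff_apply]
  funext i
  rw [PowerSeries.coeff_one]
  by_cases hi : (i : ℕ) = 0
  · have hi' : i = ⟨0, pow_pos hp.out.pos n⟩ := Fin.ext hi
    rw [if_pos hi, map_one, ZMod.val_one, Nat.cast_one, one_smul, hi', Pi.single_eq_same]
  · have hi' : i ≠ ⟨0, pow_pos hp.out.pos n⟩ := fun h ↦ hi (by rw [h])
    rw [if_neg hi, map_zero, ZMod.val_zero, Nat.cast_zero, zero_smul, Pi.single_eq_of_ne hi']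

end Extraction

/-! ## §4 Equivariance: `Ξ` is a morphism of discrete Galois modules `M ⊗ A_{m,1}(ψ) → 𝒯_{p^n}` -/

section Equivariance

variable {K : Type u} [Field K] {p : ℕ} [hp : Fact p.Prime] (κ : ZpExtension K p)
variable {M : Type u} [AddCommGroup M] [TopologicalSpace M] [DiscreteTopology M]
variable (ρ : DiscreteGaloisModule K M) (hM : ∀ x : M, p • x = 0) {m : ℕ} (hm : 1 ≤ m) (n : ℕ) (hn : p ^ n ≤ m)

/-- **The comparison `Ξ : M ⊗ A_{m,1}(ψ) → 𝒯_{p^n}` is `Γ_K`-equivariant** (`p^n ≤ m`): on `c ⊗ a`, `σ` acts by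
`(1+T)^{κ(σ)} ⊗ ρ(σ)` on the source and by `(1+S)^{κ(σ)} ∘ ρ(σ)` on the target, `Ξ` carries `1 + T` to `1 + S`, and
the two exponents (taken at the levels `eisensteinLevel hm 1` and `p^n`) agree modulo `p^n`, the period of `1 + S` on
`Fin p^n → M`. [cite: Howard2004HeegnerKolyvagin, §2.2 (T_𝔮 = 𝐓 ⊗_Λ S_𝔮)] [cite: Washington1997, §13.1–§13.2]
[cite: SerreGaloisCohomology1997, I §2.5] -/
def eisensteinToTwistModP :
    (κ.eisensteinTwist ρ hm 1).toContRepresentation →ⁱL (κ.twistModP ρ hM (p ^ n)).toContRepresentation where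
  toContinuousLinearMap :=
    ⟨(eisensteinToTwistModPAdd (p := p) hM n hn).toIntLinearMap, continuous_of_discreteTopology⟩
  isIntertwining' σ := by
    refine ContinuousLinearMap.ext fun x ↦ ?_
    change eisensteinToTwistModPAdd (p := p) hM n hn (κ.eisensteinTwist ρ hm 1 σ x) =
      κ.twistModP ρ hM (p ^ n) σ (eisensteinToTwistModPAdd (p := p) hM n hn x)
    -- both exponents reduce to `twistExponent n σ` on `Fin p^n → M`
    have hL : IwasawaAlgebra.EisensteinCoeff.onePlusT p m 1 ^ (p ^ (eisensteinLevel (p := p) hm 1 + n)) = 1 := by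
      rw [pow_add, pow_mul, onePlusT_pow_prime_pow_eisensteinLevel, one_pow]
    have he₁ : unipotentPow M (p ^ n) (κ.twistExponent (eisensteinLevel (p := p) hm 1 + n) σ) =
        unipotentPow M (p ^ n) (κ.twistExponent n σ) := by
      rw [← κ.twistExponent_mod_pow _ (Nat.le_add_left n _) σ, unipotentPow_mod hM le_rfl]
    have he₂ : unipotentPow M (p ^ n) (κ.twistExponent (p ^ n) σ) = unipotentPow M (p ^ n) (κ.twistExponent n σ) := by
      rw [← κ.twistExponent_mod_pow (p ^ n) (Nat.lt_pow_self hp.out.one_lt).le σ, unipotentPow_mod hM le_rfl]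
    induction x using IwasawaAlgebra.EisensteinCoeff.Twisted.induction_on with
    | zero => rw [map_zero, map_zero, map_zero]
    | tmul c a =>
      obtain ⟨f, rfl⟩ := Ideal.Quotient.mk_surjective c
      rw [eisensteinTwist_apply_tmul, κ.pow_twistExponent_eq_of_pow_eq_one
          (onePlusT_pow_prime_pow_eisensteinLevel (p := p) hm 1) hL σ,
        ← IwasawaAlgebra.EisensteinCoeff.Twisted.smul_tmul, eisensteinToTwistModPAdd_onePlusT_pow_smul, he₁,
        twistModP_apply, he₂, eisensteinToTwistModPAdd_tmul_mk, eisensteinToTwistModPAdd_tmul_mk]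
      congr 1
      funext i
      rw [map_zsmul]
    | add x y hx hy => rw [map_add, map_add, hx, hy, map_add, map_add]

/-- Unfolding `eisensteinToTwistModP` to the additive map. [cite: Washington1997, §13.1–§13.2] -/
@[simp] theorem eisensteinToTwistModP_apply (x : IwasawaAlgebra.EisensteinCoeff.Twisted p m 1 M) :
    κ.eisensteinToTwistModP ρ hM hm n hn x = eisensteinToTwistModPAdd (p := p) hM n hn x := rfl

end Equivariance

/-! ## §5 Cohomology: `H¹(Ξ) ∘ coresEisenstein = coresShapiro ∘ cor`, and `H¹(Ξ)` kills `H¹([T^j] •)` -/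

section Cohomology

variable {K : Type u} [Field K] {p : ℕ} [hp : Fact p.Prime] (κ : ZpExtension K p)
variable {M : Type u} [AddCommGroup M] [TopologicalSpace M] [DiscreteTopology M]
variable (ρ : DiscreteGaloisModule K M) (hM : ∀ x : M, p • x = 0) {m : ℕ} (hm : 1 ≤ m) (n : ℕ) (hn : p ^ n ≤ m)

/-- **`H¹(Ξ)` after Howard's level-one control map is the transfer of the Shapiro unit**: for an open subgroup
`N ≤ Γ_{J(m,1)} ∩ Γ_n` of finite index, `H¹(Ξ) (coresEisenstein_{(m,1),N} c) = cor_N (H¹(a ↦ a·T⁰) c)` (`cor` is natural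
in the coefficients and `Ξ (1 ⊗ a) = a · T⁰`). [cite: SerreGaloisCohomology1997, I §2.4–§2.5 (Cor is natural; Shapiro)]
[cite: Howard2004HeegnerKolyvagin, §2.2, Lemma 2.2.7 / Prop. 2.2.8] -/
theorem map_eisensteinToTwistModP_coresEisenstein (N : Subgroup (absoluteGaloisGroup K))
    (hN : N ≤ κ.layerSubgroup (eisensteinLevel (p := p) hm 1)) (hNn : N ≤ κ.layerSubgroup n)
    (hNo : IsOpen (N : Set (absoluteGaloisGroup K))) [Fintype (absoluteGaloisGroup K ⧸ N)]
    (c : continuousCohomology 1 (subgroupRep ρ.toTopRep N)) :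
    galoisCohomology.map (κ.eisensteinToTwistModP ρ hM hm n hn) 1 (κ.coresEisenstein ρ hm 1 N hN hNo c) =
      cores (κ.twistModP ρ hM (p ^ n)).toTopRep N hNo
        (cohomologyMap (restrictHomOfLe (X := ρ.toTopRep) (Y := (κ.twistModP ρ hM (p ^ n)).toTopRep)
          (H := N) (H' := κ.layerSubgroup n) hNn (κ.unitCoeffHom ρ hM n)) 1 c) := by
  obtain ⟨φ, rfl⟩ := oneCocycleClass_surjective _ c
  set R : (κ.eisensteinTwist ρ hm 1).toTopRep ⟶ (κ.twistModP ρ hM (p ^ n)).toTopRep :=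
    TopRep.ofHom ⟨(κ.eisensteinToTwistModP ρ hM hm n hn).toContinuousLinearMap,
      (κ.eisensteinToTwistModP ρ hM hm n hn).isIntertwining'⟩ with hR
  change cohomologyMap R 1 (cores _ _ _
      (cohomologyMap (κ.eisensteinUnitCoeffHom ρ hm 1 N hN) 1 (oneCocycleClass _ φ))) =
    cores _ _ _ (cohomologyMap _ 1 (oneCocycleClass _ φ))
  have hinner : cohomologyMap (subgroupRepHom R N) 1
        (cohomologyMap (κ.eisensteinUnitCoeffHom ρ hm 1 N hN) 1 (oneCocycleClass _ φ)) =
      cohomologyMap (restrictHomOfLe (X := ρ.toTopRep) (Y := (κ.twistModP ρ hM (p ^ n)).toTopRep)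
          (H := N) (H' := κ.layerSubgroup n) hNn (κ.unitCoeffHom ρ hM n)) 1 (oneCocycleClass _ φ) := by
    rw [cohomologyMap_oneCocycleClass, cohomologyMap_oneCocycleClass, cohomologyMap_oneCocycleClass]
    refine congrArg _ (Subtype.ext (ContinuousMap.ext fun x ↦ ?_))
    rw [pullback_id_resIdHom_apply, pullback_id_resIdHom_apply, pullback_id_resIdHom_apply, subgroupRepHom_hom_apply,
      eisensteinUnitCoeffHom_hom_apply, restrictHomOfLe_hom_apply, unitCoeffHom_hom_apply]
    exact eisensteinToTwistModPAdd_eisensteinUnitCoeff (p := p) hM n hn (φ.1 x)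
  rw [cohomologyMap_cores, hinner]

/-- **`H¹(Ξ) ∘ coresEisenstein_{(m,1),N} = coresShapiro n ∘ cor_{N → Γ_n}`** (transitivity of the transfer + its
naturality in the coefficients). [cite: SerreGaloisCohomology1997, I §2.4–§2.5]
[cite: Howard2004HeegnerKolyvagin, §2.2, Prop. 2.2.8 and proof of Thm. 2.2.10 (𝔮 = T^m + p)] -/
theorem map_eisensteinToTwistModP_coresEisenstein_eq_coresShapiro (N : Subgroup (absoluteGaloisGroup K))
    (hN : N ≤ κ.layerSubgroup (eisensteinLevel (p := p) hm 1)) (hNn : N ≤ κ.layerSubgroup n)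
    (hNo : IsOpen (N : Set (absoluteGaloisGroup K))) [Fintype (absoluteGaloisGroup K ⧸ N)]
    [Fintype (absoluteGaloisGroup K ⧸ κ.layerSubgroup n)] [Fintype (κ.layerSubgroup n ⧸ N.subgroupOf (κ.layerSubgroup n))]
    (c : continuousCohomology 1 (subgroupRep ρ.toTopRep N)) :
    galoisCohomology.map (κ.eisensteinToTwistModP ρ hM hm n hn) 1 (κ.coresEisenstein ρ hm 1 N hN hNo c) =
      κ.coresShapiro ρ hM n (coresLe ρ.toTopRep hNn hNo c) := by
  rw [map_eisensteinToTwistModP_coresEisenstein]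
  change _ = cores _ _ _ (cohomologyMap (κ.unitCoeffHom ρ hM n) 1 (coresLe ρ.toTopRep hNn hNo c))
  rw [cohomologyMap_coresLe, cores_coresLe_eq_cores]

include hM hn in
/-- **Howard's level-one control map detects the classes of `H¹(K_n, M)`**: if `coresEisenstein_{(m,1),N} c = 0`
(`p^n ≤ m`) then `cor_{N → Γ_n} c = 0` in `H¹(Γ_n, M)` (by the Shapiro bijection `coresShapiro_bijective`).
[cite: SerreGaloisCohomology1997, I §2.5 Prop. 10] [cite: Howard2004HeegnerKolyvagin, §2.2, Prop. 2.2.8] -/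
theorem coresLe_eq_zero_of_coresEisenstein_eq_zero [CompactSpace (absoluteGaloisGroup K)] (N : Subgroup (absoluteGaloisGroup K))
    (hN : N ≤ κ.layerSubgroup (eisensteinLevel (p := p) hm 1)) (hNn : N ≤ κ.layerSubgroup n)
    (hNo : IsOpen (N : Set (absoluteGaloisGroup K))) [Fintype (absoluteGaloisGroup K ⧸ N)]
    [Fintype (absoluteGaloisGroup K ⧸ κ.layerSubgroup n)] [Fintype (κ.layerSubgroup n ⧸ N.subgroupOf (κ.layerSubgroup n))]
    {c : continuousCohomology 1 (subgroupRep ρ.toTopRep N)} (hc : κ.coresEisenstein ρ hm 1 N hN hNo c = 0) :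
    coresLe ρ.toTopRep hNn hNo c = 0 := by
  rw [← κ.coresShapiro_eq_zero_iff ρ hM n, ← map_eisensteinToTwistModP_coresEisenstein_eq_coresShapiro κ ρ hM hm n hn
    N hN hNn hNo, hc, map_zero]

/-- **`H¹(Ξ)` kills `H¹([T^j] •)`** for `p^n ≤ j`: `H¹(Ξ) (H¹([T^j] •) x) = 0` on `H¹(K, M ⊗ A_{m,1}(ψ))`.
[cite: Washington1997, §13.1–§13.2 (T^J = 0 on Λ/(p, T^J))] [cite: Howard2004HeegnerKolyvagin, §2.2] -/
theorem map_eisensteinToTwistModP_map_smul_X_pow {j : ℕ} (hj : p ^ n ≤ j)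
    (x : galoisCohomology (κ.eisensteinTwist ρ hm 1) 1) :
    galoisCohomology.map (κ.eisensteinToTwistModP ρ hM hm n hn) 1
      (galoisCohomology.map (κ.eisensteinTwistSMulHom ρ hm 1
        (Ideal.Quotient.mk _ ((PowerSeries.X : IwasawaAlgebra p) ^ j))) 1 x) = 0 := by
  obtain ⟨φ, rfl⟩ := oneCocycleClass_surjective _ x
  set RΞ : (κ.eisensteinTwist ρ hm 1).toTopRep ⟶ (κ.twistModP ρ hM (p ^ n)).toTopRep :=
    TopRep.ofHom ⟨(κ.eisensteinToTwistModP ρ hM hm n hn).toContinuousLinearMap,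
      (κ.eisensteinToTwistModP ρ hM hm n hn).isIntertwining'⟩ with hRΞ
  set RX : (κ.eisensteinTwist ρ hm 1).toTopRep ⟶ (κ.eisensteinTwist ρ hm 1).toTopRep :=
    TopRep.ofHom ⟨(κ.eisensteinTwistSMulHom ρ hm 1
        (Ideal.Quotient.mk _ ((PowerSeries.X : IwasawaAlgebra p) ^ j))).toContinuousLinearMap,
      (κ.eisensteinTwistSMulHom ρ hm 1 (Ideal.Quotient.mk _ ((PowerSeries.X : IwasawaAlgebra p) ^ j))).isIntertwining'⟩
    with hRX
  change cohomologyMap RΞ 1 (cohomologyMap RX 1 (oneCocycleClass _ φ)) = 0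
  rw [cohomologyMap_oneCocycleClass, cohomologyMap_oneCocycleClass]
  have h0 : contOneCocycles.pullback (ContinuousMonoidHom.id _) (resIdHom RΞ)
      (contOneCocycles.pullback (ContinuousMonoidHom.id _) (resIdHom RX) φ) = 0 :=
    Subtype.ext (ContinuousMap.ext fun g ↦ by
      rw [pullback_id_resIdHom_apply, pullback_id_resIdHom_apply]
      exact eisensteinToTwistModPAdd_mk_X_pow_smul_eq_zero (p := p) hM n hn hj (φ.1 g))
  rw [h0, oneCocycleClass_zero]

end Cohomology

end ZpExtension

end Literature.NumberTheory.EllipticCurves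

end
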